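import Literature.NumberTheory.EllipticCurves.SemistableModPImageReducibleProofs
import Literature.NumberTheory.DiophantineGeometry.GeneralizedFermatTwoPowerCoefficientFreyProofs
import Literature.NumberTheory.DiophantineGeometry.GeneralizedFermatTwoPowerCoefficientFreySaitoProofs
import Literature.NumberTheory.DiophantineGeometry.LocalReductionProofs
import Literature.NumberTheory.EllipticCurves.GlobalMinimalModelProofs
import Literature.NumberTheory.EllipticCurves.VariableChangePointsMap
import HarnessLib

/-!
# Crux `FreyModularity` (stmt-ABC-11340), line `Sketch`: the stub `stub_freySemistableDichotomy`
# (Serre 1972, §5.4 Prop. 21 ii), on the `16 ∣ B` Frey curves) — proved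

The registered stub `stub_freySemistableDichotomy` of the line `Sketch` of the crux
`Summit.ABC.ABC.Theses.DefiniteXi.FreyModularity`: **for coprime `A, B` with `AB(A+B) ≠ 0`,
`A ≡ −1 (mod 4)` and `16 ∣ B`, every `Γ_ℚ`-stable subgroup `H` of `E[5]`, `E = E_(A,B) :
y² = x(x − A)(x + B)` the Frey curve, other than `0` and `E[5]`, is fixed pointwise by `Γ_ℚ` or
has trivial quotient character** (`σ • Q − Q ∈ H` for all `σ`, `Q`).  This is Serre's
Prop. 21 ii) (Invent. Math. 15 (1972), §5.4; Edixhoven 1997, Prop. 2.1, reducible case) for the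
semistable curve `E`:

* `isSemistable_freyCurve_of_sixteen_dvd` (tree; Ribet 1997, §2, p. 11 / Diamond–Kramer 1995,
  Lemma 2): for `A ≡ −1 (mod 4)`, `16 ∣ B` the Frey curve is semistable at every prime (over `ℤ`;
  over `𝓞 ℚ` by `isSemistable_ringOfIntegers_of_isSemistable_int`);
* `WeierstrassCurve.smul_eq_or_smul_sub_mem_of_isSemistable` (tree; Serre's Prop. 21 ii)) is
  stated for a GLOBALLY MINIMAL semistable model, which `freyCurve A B` is not (it is not minimal
  at `2` when `16 ∣ B`); so we pass to a global minimal model `C • E`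
  (`hasGlobalMinimalModel_rat_holds`, Silverman *AEC* VIII.8.3), which is again semistable
  (`isSemistable_smul_iff_holds`, *AEC* VII.5.1), and transport stable lines and the dichotomy
  along the `Γ_ℚ`-equivariant additive bijection `E[p] ≃+ (C • E)[p]` induced by
  `VariableChange.pointEquivBaseChange` (*AEC* III.3.1(b); `exists_geomTorsion_addEquiv_smul`,
  `smul_eq_or_smul_sub_mem_of_addEquiv`);
* `smul_eq_or_smul_sub_mem_of_isSemistable_int` — Prop. 21 ii) for ANY Weierstrass model of a
  semistable `E/ℚ` (semistability over `ℤ`), the form the Frey family needs;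
* `stub_freySemistableDichotomy` — the registered signature, by the two items above.

## References

* [Serre1972] J.-P. Serre, *Propriétés galoisiennes des points d'ordre fini des courbes
  elliptiques*, Invent. Math. 15 (1972) 259–331, §5.4 Prop. 21 ii).
* [Edixhoven1997] B. Edixhoven, *Serre's conjecture*, in Cornell–Silverman–Stevens (1997),
  Prop. 2.1 (PDF p. 285).
* [Ribet1997] K. A. Ribet, *On the equation `a^p + 2^α b^p + c^p = 0`*, Acta Arith. 79 (1997),
  §2, p. 11.
* [SilvermanAEC2009] J. H. Silverman, *The Arithmetic of Elliptic Curves*, 2nd ed. (2009),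
  III.3.1(b), VII.5 Prop. 5.1, VIII.8 Cor. 8.3.
-/

-- `Summit.<Summit>.<Problem>` is the mandated summit-side namespace (CONVENTIONS §2); for the
-- single-conjunct summit `ABC` the two coincide, so the duplicate `ABC.ABC` is deliberate.
set_option linter.dupNamespace false

noncomputable section

open scoped NumberField

open Field IsDedekindDomain
open Literature.NumberTheory.EllipticCurves
open Literature.NumberTheory.DiophantineGeometry
open WeierstrassCurve

universe u

namespace Summit.ABC.ABC.Theorems

/-! ## Transport of Serre's dichotomy along an equivariant isomorphism of the `p`-torsion -/

/-- **Transport of the dichotomy of Prop. 21 ii) along a `Γ_F`-equivariant additive isomorphism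
`e : W[p] ≃+ W'[p]`**: if every `Γ_F`-stable subgroup `H' ≠ 0, W'[p]` of `W'[p]` is fixed
pointwise or has trivial quotient character, the same holds for `W[p]` (apply the hypothesis to
`H' = e(H)`, i.e. the preimage of `H` under `e⁻¹`). [folklore] -/
theorem smul_eq_or_smul_sub_mem_of_addEquiv {F : Type u} [Field F] {W W' : WeierstrassCurve F}
    {p : ℕ} (e : geomTorsion W p ≃+ geomTorsion W' p)
    (he : ∀ (σ : absoluteGaloisGroup F) (P : geomTorsion W p), e (σ • P) = σ • e P)
    (h : ∀ H' : AddSubgroup (geomTorsion W' p),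
      (∀ σ : absoluteGaloisGroup F, ∀ Q ∈ H', σ • Q ∈ H') → H' ≠ ⊥ → H' ≠ ⊤ →
      (∀ σ : absoluteGaloisGroup F, ∀ Q ∈ H', σ • Q = Q) ∨
        ∀ (σ : absoluteGaloisGroup F) (Q : geomTorsion W' p), σ • Q - Q ∈ H')
    (H : AddSubgroup (geomTorsion W p))
    (hst : ∀ σ : absoluteGaloisGroup F, ∀ P ∈ H, σ • P ∈ H) (hbot : H ≠ ⊥) (htop : H ≠ ⊤) :
    (∀ σ : absoluteGaloisGroup F, ∀ P ∈ H, σ • P = P) ∨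
      ∀ (σ : absoluteGaloisGroup F) (P : geomTorsion W p), σ • P - P ∈ H := by
  -- `H' = e(H)`, realised as the preimage of `H` under `e⁻¹`
  let H' : AddSubgroup (geomTorsion W' p) := H.comap e.symm.toAddMonoidHom
  have hmem : ∀ Q : geomTorsion W' p, Q ∈ H' ↔ e.symm Q ∈ H := fun Q ↦ Iff.rfl
  have hmem' : ∀ P : geomTorsion W p, e P ∈ H' ↔ P ∈ H := fun P ↦ by
    rw [hmem, e.symm_apply_apply]
  have he' : ∀ (σ : absoluteGaloisGroup F) (Q : geomTorsion W' p),
      e.symm (σ • Q) = σ • e.symm Q := fun σ Q ↦ by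
    apply e.injective
    rw [e.apply_symm_apply, he, e.apply_symm_apply]
  have hst' : ∀ σ : absoluteGaloisGroup F, ∀ Q ∈ H', σ • Q ∈ H' := fun σ Q hQ ↦ by
    rw [hmem] at hQ ⊢
    rw [he']
    exact hst σ _ hQ
  have hbot' : H' ≠ ⊥ := fun hb ↦ hbot (by
    rw [eq_bot_iff]
    intro P hP
    have hP' : e P ∈ H' := (hmem' P).mpr hP
    rw [hb, AddSubgroup.mem_bot, e.map_eq_zero_iff] at hP'
    rw [hP']
    exact AddSubgroup.zero_mem _)
  have htop' : H' ≠ ⊤ := fun ht ↦ htop (by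
    rw [eq_top_iff]
    intro P _
    have hP' : e P ∈ H' := ht ▸ AddSubgroup.mem_top _
    exact (hmem' P).mp hP')
  rcases h H' hst' hbot' htop' with hfix | hquot
  · left
    intro σ P hP
    apply e.injective
    rw [he]
    exact hfix σ (e P) ((hmem' P).mpr hP)
  · right
    intro σ P
    have hq := hquot σ (e P)
    rw [hmem, map_sub, he', e.symm_apply_apply] at hq
    exact hq

/-- **`E[p] ≃ (C • E)[p]`, `Γ_F`-equivariantly** (Silverman *AEC* III.3.1(b): the bijection
`E(F̄) ≃+ (C • E)(F̄)` of a change of Weierstrass equation over `F`,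
`VariableChange.pointEquivBaseChange`, is additive and commutes with `Γ_F`
(`pointEquivBaseChange_map_algEquiv`), so it restricts to the `p`-torsion).  The construction is
the one in the tree's proof of `Mazur1978.hasIrreducibleModPGaloisRep_smul_iff`. [folklore] -/
theorem exists_geomTorsion_addEquiv_smul {F : Type u} [Field F] (W : WeierstrassCurve F)
    (C : VariableChange F) (p : ℕ) :
    ∃ e : geomTorsion W p ≃+ geomTorsion (C • W) p,
      ∀ (σ : absoluteGaloisGroup F) (P : geomTorsion W p), e (σ • P) = σ • e P := by
  classical
  let e : geomPoints W ≃+ geomPoints (C • W) :=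
    VariableChange.pointEquivBaseChange W C (AlgebraicClosure F)
  have hsmul : ∀ (σ : absoluteGaloisGroup F) (P : geomPoints W), e (σ • P) = σ • e P := fun σ P ↦
    VariableChange.pointEquivBaseChange_map_algEquiv W C (absoluteGaloisGroup.toAlgEquiv F σ) P
  have htor : ∀ {P : geomPoints W}, P ∈ geomTorsion W p ↔ e P ∈ geomTorsion (C • W) p := by
    intro P
    rw [geomTorsion, geomTorsion, AddSubgroup.torsionBy.nsmul_iff, AddSubgroup.torsionBy.nsmul_iff,
      ← map_nsmul, AddEquiv.map_eq_zero_iff]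
  let eₚ : geomTorsion W p ≃+ geomTorsion (C • W) p :=
    { toFun := fun P ↦ ⟨e P, htor.mp P.2⟩
      invFun := fun Q ↦ ⟨e.symm Q, by rw [htor, e.apply_symm_apply]; exact Q.2⟩
      left_inv := fun P ↦ Subtype.ext (e.symm_apply_apply _)
      right_inv := fun Q ↦ Subtype.ext (e.apply_symm_apply _)
      map_add' := fun P Q ↦ Subtype.ext (by
        change e ((P : geomPoints W) + Q) = e P + e Q
        exact map_add e _ _) }
  refine ⟨eₚ, fun σ P ↦ Subtype.ext ?_⟩
  change e ((σ • P : geomTorsion W p) : geomPoints W) = _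
  rw [AddSubgroup.torsionBy.coe_smul, hsmul]
  rfl

/-! ## Serre's Prop. 21 ii) for any model of a semistable `E/ℚ` -/

/-- **Serre 1972, §5.4 Prop. 21 ii) for an arbitrary Weierstrass model of a semistable elliptic
curve `E/ℚ`** (semistability over `ℤ`): a `Γ_ℚ`-stable subgroup `H ≠ 0, E[p]` of `E[p]` is
fixed pointwise by `Γ_ℚ`, or `Γ_ℚ` acts trivially on `E[p]/H`.  The tree's
`WeierstrassCurve.smul_eq_or_smul_sub_mem_of_isSemistable` (globally minimal models) applied to
a global minimal model `C • E` (`hasGlobalMinimalModel_rat_holds`; semistable by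
`isSemistable_smul_iff_holds` and `isSemistable_ringOfIntegers_of_isSemistable_int`) and
transported back along `E[p] ≃+ (C • E)[p]`.
[cite: Serre1972, §5.4 Prop. 21 ii)] [cite: Edixhoven1997, Prop. 2.1 (PDF p. 285)] -/
theorem smul_eq_or_smul_sub_mem_of_isSemistable_int (W : WeierstrassCurve ℚ) [W.IsElliptic]
    (p : ℕ) [Fact p.Prime] (hsemi : W.IsSemistable ℤ) (H : AddSubgroup (geomTorsion W p))
    (hst : ∀ σ : absoluteGaloisGroup ℚ, ∀ Q ∈ H, σ • Q ∈ H) (hbot : H ≠ ⊥) (htop : H ≠ ⊤) :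
    (∀ σ : absoluteGaloisGroup ℚ, ∀ Q ∈ H, σ • Q = Q) ∨
      ∀ (σ : absoluteGaloisGroup ℚ) (Q : geomTorsion W p), σ • Q - Q ∈ H := by
  obtain ⟨C, hC⟩ := hasGlobalMinimalModel_rat_holds W
  have hsemi' : (C • W).IsSemistable (𝓞 ℚ) :=
    (isSemistable_smul_iff_holds (𝓞 ℚ) W C).mpr
      (isSemistable_ringOfIntegers_of_isSemistable_int W hsemi)
  obtain ⟨e, he⟩ := exists_geomTorsion_addEquiv_smul W C p
  exact smul_eq_or_smul_sub_mem_of_addEquiv e he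
    (fun H' ↦ smul_eq_or_smul_sub_mem_of_isSemistable (C • W) p hsemi' H') H hst hbot htop

/-! ## The Frey curve with `16 ∣ B` -/

/-- **Serre's dichotomy on the semistable Frey curves** (curried form): for coprime `A, B` with
`AB(A+B) ≠ 0`, `A ≡ −1 (mod 4)`, `16 ∣ B`, the Frey curve `E_(A,B)` is semistable at every
prime (`isSemistable_freyCurve_of_sixteen_dvd`; Ribet 1997, §2, p. 11; Diamond–Kramer 1995,
Lemma 2), so every `Γ_ℚ`-stable subgroup `H ≠ 0, E[5]` of `E[5]` is fixed pointwise or has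
trivial quotient character (`smul_eq_or_smul_sub_mem_of_isSemistable_int`, Serre's
Prop. 21 ii)). [cite: Serre1972, §5.4 Prop. 21 ii)] [cite: Ribet1997, §2, p. 11] -/
theorem smul_eq_or_smul_sub_mem_freyCurve_of_sixteen_dvd {A B : ℤ} (hAB : IsCoprime A B)
    (h0 : A * B * (A + B) ≠ 0) (hA : A ≡ -1 [ZMOD 4]) (hB : (16 : ℤ) ∣ B)
    (H : AddSubgroup (geomTorsion (freyCurve A B) (5 : ℕ)))
    (hst : ∀ σ : absoluteGaloisGroup ℚ, ∀ P ∈ H, σ • P ∈ H) (hbot : H ≠ ⊥) (htop : H ≠ ⊤) :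
    (∀ σ : absoluteGaloisGroup ℚ, ∀ P ∈ H, σ • P = P) ∨
      ∀ (σ : absoluteGaloisGroup ℚ) (Q : geomTorsion (freyCurve A B) (5 : ℕ)), σ • Q - Q ∈ H := by
  haveI := isElliptic_freyCurve h0
  haveI : Fact (Nat.Prime 5) := ⟨Nat.prime_five⟩
  exact smul_eq_or_smul_sub_mem_of_isSemistable_int (freyCurve A B) 5
    (isSemistable_freyCurve_of_sixteen_dvd hAB h0 hA hB) H hst hbot htop

/-- **Stub S5 of the line `Sketch` — the semistable branch (Serre 1972, §5.4 Prop. 21 ii), on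
the `16 ∣ B` Frey curves)**, registered signature.  For coprime `A, B` with `AB(A+B) ≠ 0`,
`A ≡ −1 (mod 4)` and `16 ∣ B`, the Frey curve `E_(A,B) : y² = x(x − A)(x + B)` is semistable at
every prime, hence for every `Γ_ℚ`-stable subgroup `H` of `E[5]` other than `0` and `E[5]`,
either `Γ_ℚ` fixes `H` pointwise or it acts trivially on `E[5]/H`
(`smul_eq_or_smul_sub_mem_freyCurve_of_sixteen_dvd`). [cite: Serre1972, §5.4 Prop. 21 ii)] -/
theorem stub_freySemistableDichotomy :
    ∀ (A B : ℤ) [(freyCurve A B).IsElliptic], IsCoprime A B → A * B * (A + B) ≠ 0 →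
      A ≡ -1 [ZMOD 4] → (16 : ℤ) ∣ B →
      ∀ H : AddSubgroup (geomTorsion (freyCurve A B) (5 : ℕ)),
        (∀ σ : Field.absoluteGaloisGroup ℚ, ∀ P ∈ H, σ • P ∈ H) → H ≠ ⊥ → H ≠ ⊤ →
        (∀ σ : Field.absoluteGaloisGroup ℚ, ∀ P ∈ H, σ • P = P) ∨
          ∀ (σ : Field.absoluteGaloisGroup ℚ) (Q : geomTorsion (freyCurve A B) (5 : ℕ)),
            σ • Q - Q ∈ H :=
  fun _ _ _ hAB h0 hA hB H hst hbot htop ↦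
    smul_eq_or_smul_sub_mem_freyCurve_of_sixteen_dvd hAB h0 hA hB H hst hbot htop

end Summit.ABC.ABC.Theorems

end
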